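import Mathlib
import Summits.ResolutionOfSingularities.ResolutionOfSingularities.Theorems.WeightedInvariantLocalWeightedDropTOT2StepBlowOne
import Summits.ResolutionOfSingularities.ResolutionOfSingularities.Theorems.WeightedInvariantLocalWeightedDropTOT2StepCurve
import Summits.ResolutionOfSingularities.ResolutionOfSingularities.Theorems.WeightedInvariantLocalWeightedDropTOT2StepBlowTwo

/-!
# TOT2-LINE (P3) B6 steps 1–4 RESTATED WITH THE DIMENSION-AWARE TRANSPORT BRICK B4

ENGINE crux `stmt-ResolutionOfSingularities-8899` (`LocalWeightedDrop`), skeleton v35, registered stub `stub_conflictBudget` (P3).  [OURS · L1 W4.3 ·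
res-L1-w43-stub-2 g6; def-free; nothing here is a statement of any manuscript; AI-produced, gate-checked, weaker than expert review.]
The landed steps (`…TOT2StepBlowOne/Curve/BlowTwo`) take brick B4 in its split-v1 shape; the brick LANDED (`…TOT2TopPrimesChartComap`) with one
more antecedent `ringKrullDim (R₃ ⧸ P′) = 1`.  The proofs only use B4 above one-dimensional primes, so they go through verbatim with the
dimension-aware shape (suffix `D`); these are the variants the glue `conflictBudget_laws` instantiates.
* `conflictBudgetD_blowOneT_leD/ltD`, `conflictBudgetD_le_of_planeFixingD`, `conflictBudgetD_blowTwoT_leD/ltD`.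
-/

set_option linter.dupNamespace false -- mandated namespace of this single-conjunct summit

noncomputable section

namespace Summit.ResolutionOfSingularities.ResolutionOfSingularities.Theorems

namespace TOT2Branch

open MvPowerSeries IsLocalRing PolyDescent Literature.AlgebraicGeometry.Resolution

variable {k : Type} [Field k]

section Step

variable {d : ℕ} {A : Fin d → MvPowerSeries (Fin 2) k} {N N' : Finset (Fin 2)}
  (Φ : MvPowerSeries (Fin 3) k →ₐ[k] MvPowerSeries (Fin 3) k)

/-- **B6 STEP `u₁`-ORIGIN, WITH SLACK.**  Under the context for `(A, N)`, `InPoly d A`, and the bricks B3 / B4-1 / D3 / injectivity for the chart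
`Φ = (u₁, u₁u₂, u₁y)`: the budget of `(blowOneT d A, insert 0 (N.filter (· = 1)))` plus (the letter bit, if the conflict branch survives) is at
most the budget of `(A, N)` — packaged as: `M′ ≤ M`, and `M′ < M` whenever some non-line top-locus prime of `A` with positive charge either
dies or survives with `β = 1`.  Both laws below are corollaries. -/
theorem conflictBudgetD_blowOneT_leD (p : ℕ) [Fact p.Prime] [CharP k p] [IsAlgClosed k]
    (hΦ : ∀ f, Φ f = subst (![X 0, X 0 * X 1, X 0 * X 2] : Fin 3 → MvPowerSeries (Fin 3) k) f)
    (hB3 : ∀ (P' : Ideal (MvPowerSeries (Fin 3) k)) [P'.IsPrime], ringKrullDim (MvPowerSeries (Fin 3) k ⧸ P') = 1 →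
      (X 0 : MvPowerSeries (Fin 3) k) ∉ P' →
      ringKrullDim (MvPowerSeries (Fin 3) k ⧸ P'.comap Φ) = 1 ∧ ∀ f, branchVal (P'.comap Φ) f = branchVal P' (Φ f))
    (hB4 : ∀ (P' : Ideal (MvPowerSeries (Fin 3) k)), P' ∈ topPrimes d (blowOneT d A) → ringKrullDim (MvPowerSeries (Fin 3) k ⧸ P') = 1 → (X 0 : MvPowerSeries (Fin 3) k) ∉ P' →
      P'.comap Φ ∈ topPrimes d A)
    (hD3 : ∀ (P Q : Ideal (MvPowerSeries (Fin 3) k)), P ∈ topPrimes d A → Q ∈ topPrimes d A → P ≠ Q →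
      ringKrullDim (MvPowerSeries (Fin 3) k ⧸ P) = 1 → ringKrullDim (MvPowerSeries (Fin 3) k ⧸ Q) = 1 → pairVal P Q < ⊤)
    (hinj : ∀ (P' Q' : Ideal (MvPowerSeries (Fin 3) k)), P'.IsPrime → Q'.IsPrime → ringKrullDim (MvPowerSeries (Fin 3) k ⧸ P') = 1 →
      ringKrullDim (MvPowerSeries (Fin 3) k ⧸ Q') = 1 → (X 0 : MvPowerSeries (Fin 3) k) ∉ P' → (X 0 : MvPowerSeries (Fin 3) k) ∉ Q' →
      P'.comap Φ = Q'.comap Φ → P' = Q')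
    (hctx : ∃ (b : MvPowerSeries (Fin (2 + 1)) k) (δ : TameFourTupleDrop.Decoration k 2) (Θ : Fin (2 + 1) → MvPowerSeries (Fin (2 + 1)) k),
      TameFourTupleDrop.Admissible b δ ∧ 2 ≤ δ.o ∧ δ.c = d ∧ δ.PresBy d A N Θ)
    (hin : InPoly d A) (hN' : N' = insert 0 (N.filter fun l => l = 1)) :
    conflictBudgetD d (blowOneT d A) N' ≤ conflictBudgetD d A N ∧
      ∀ P₀ ∈ topPrimesDNL d A, 1 ≤ betaTwo d A N →
        conflictBudgetD d (blowOneT d A) N' < conflictBudgetD d A N := by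
  classical
  have hd2 : 2 ≤ d := NCBranchPrimes.two_le_of_presContext hctx
  have hsq : Squarefree (NCPoly.monicGerm d A) := NCBranchPrimes.squarefree_monicGerm_of_presContext hctx
  set A' := blowOneT d A with hA'
  -- the chart on variables and on plane series
  have hs : HasSubst (![X 0, X 0 * X 1, X 0 * X 2] : Fin 3 → MvPowerSeries (Fin 3) k) :=
    hasSubst_of_constantCoeff_zero fun i => by fin_cases i <;> simp
  have hΦX0 : Φ (X 0) = X 0 := by rw [hΦ, subst_X hs]; rfl
  have hΦX1 : Φ (X 1) = X 0 * X 1 := by rw [hΦ, subst_X hs]; rfl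
  have hΦ₂ : ∀ g : MvPowerSeries (Fin 2) k, Φ (toThree g) = toThree (subst (![X 0, X 0 * X 1] : Fin 2 → MvPowerSeries (Fin 2) k) g) := by
    intro g
    rw [hΦ, toThree]
    exact subst_rename_eq_rename_subst _ (fun i => by fin_cases i <;> simp) _ (fun i => by fin_cases i <;> simp)
      (fun i => by fin_cases i <;> simp [rename_X, map_mul, succAbove_two_one]) g
  have hfinS : (topPrimesDNL d A).Finite := (topPrimesNL_finite p hctx).subset (topPrimesDNL_subset_topPrimesNL d A)
  set ι : Ideal (MvPowerSeries (Fin 3) k) → Ideal (MvPowerSeries (Fin 3) k) := fun P' => P'.comap Φ with hιdef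
  have hιmem : ∀ P' ∈ topPrimesDNL d A', ι P' ∈ topPrimesDNL d A := by
    intro P' hP'
    obtain ⟨⟨hP'top, hdim'⟩, hX0', hX1'⟩ := hP'
    haveI := hP'top.1
    obtain ⟨hdim, -⟩ := hB3 P' hdim' hX0'
    refine ⟨⟨hB4 P' hP'top hdim' hX0', hdim⟩, ?_, ?_⟩
    · rw [hιdef, Ideal.mem_comap]; show Φ (X 0) ∉ P'; rw [hΦX0]; exact hX0'
    · rw [hιdef, Ideal.mem_comap]; show Φ (X 1) ∉ P'; rw [hΦX1]
      exact fun h => (hP'top.1.mem_or_mem h).elim hX0' hX1'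
  have hinjOn : Set.InjOn ι (topPrimesDNL d A') := by
    intro P' hP' Q' hQ' h
    exact hinj P' Q' hP'.1.1.1 hQ'.1.1.1 hP'.1.2 hQ'.1.2 hP'.2.1 hQ'.2.1 h
  have hfinS' : (topPrimesDNL d A').Finite :=
    Set.Finite.of_finite_image (hfinS.subset (fun P hP => by obtain ⟨P', hP', rfl⟩ := hP; exact hιmem P' hP')) hinjOn
  set S := hfinS.toFinset with hSdef
  set S' := hfinS'.toFinset with hS'def
  have hmemS : ∀ {P}, P ∈ S ↔ P ∈ topPrimesDNL d A := fun {P} => Set.Finite.mem_toFinset _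
  have hmemS' : ∀ {P'}, P' ∈ S' ↔ P' ∈ topPrimesDNL d A' := fun {P'} => Set.Finite.mem_toFinset _
  have hβ : betaTwo d A' N' = betaTwo d A N := by
    refine betaTwo_congr ?_
    rw [hN', hA', isPermissibleTwoT_blowOneT_iff hin.2.1]
    simp
  have hvals : ∀ P' ∈ topPrimesDNL d A',
      branchVal P' (X 0) ≠ ⊤ ∧ branchVal P' (X 1) ≠ ⊤ ∧ 1 ≤ branchVal P' (X 0) ∧ 1 ≤ branchVal P' (X 1) ∧
      branchVal P' (X 0) = branchVal (ι P') (X 0) ∧ branchVal P' (X 0) + branchVal P' (X 1) = branchVal (ι P') (X 1) := by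
    intro P' hP'
    obtain ⟨⟨hP'top, hdim'⟩, hX0', hX1'⟩ := hP'
    haveI := hP'top.1
    obtain ⟨-, hval⟩ := hB3 P' hdim' hX0'
    refine ⟨(branchVal_eq_top_iff_of_dim hdim' _).not.mpr hX0', (branchVal_eq_top_iff_of_dim hdim' _).not.mpr hX1',
      one_le_branchVal_X_of_dim hdim' 0, one_le_branchVal_X_of_dim hdim' 1, ?_, ?_⟩
    · rw [hιdef]; show branchVal P' (X 0) = branchVal (P'.comap Φ) (X 0); rw [hval, hΦX0]
    · rw [hιdef]; show _ = branchVal (P'.comap Φ) (X 1); rw [hval, hΦX1, branchVal_mul_of_dim hdim']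
  have hc : ∀ P' ∈ S', charge d A' N' P' + betaTwo d A N ≤ charge d A N (ι P') +
      2 * ∑ Q ∈ S.filter (fun Q => Q ∉ S'.image ι), ((pairVal (ι P') Q).toNat + (pairVal Q (ι P')).toNat) := by
    intro P' hP'
    obtain ⟨ha', hb', h1a, h1b, haa, hbb⟩ := hvals P' (hmemS'.mp hP')
    exact le_add_right (charge_chartOne_le hβ ha' hb' h1a h1b haa hbb)
  have hq : ∀ P' ∈ S', ∀ Q' ∈ S', P' ≠ Q' → (pairVal P' Q').toNat ≤ (pairVal (ι P') (ι Q')).toNat := by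
    intro P' hP' Q' hQ' hne
    have hP'm := hmemS'.mp hP'
    have hQ'm := hmemS'.mp hQ'
    haveI := hP'm.1.1.1
    haveI := hQ'm.1.1.1
    obtain ⟨-, hval⟩ := hB3 P' hP'm.1.2 hP'm.2.1
    have hle : pairVal P' Q' + branchVal P' (X 0) ≤ pairVal (ι P') (ι Q') :=
      pairVal_add_le_of_transport Φ.toRingHom (subst (![X 0, X 0 * X 1] : Fin 2 → MvPowerSeries (Fin 2) k)) hΦ₂ hP'm.1.2 rfl rfl
        (fun f => (hval f).symm ▸ rfl) (X 0) hQ'm.2.1 fun g hg0 => by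
          obtain ⟨ĝ, hĝ⟩ := exists_chartOne_eq_mul hg0
          exact ⟨ĝ, by rw [hĝ, map_mul, toThree_X]; rfl⟩
    have hιne : ι P' ≠ ι Q' := fun h => hne (hinjOn hP'm hQ'm h)
    have hfin : pairVal (ι P') (ι Q') < ⊤ :=
      hD3 _ _ (hιmem P' hP'm).1.1 (hιmem Q' hQ'm).1.1 hιne (hιmem P' hP'm).1.2 (hιmem Q' hQ'm).1.2
    exact ENat.toNat_le_toNat (le_trans le_self_add hle) hfin.ne
  have hιS : ∀ P' ∈ S', ι P' ∈ S := fun P' hP' => hmemS.mpr (hιmem P' (hmemS'.mp hP'))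
  have hinjS : Set.InjOn ι S' := fun P' hP' Q' hQ' h => hinjOn (hmemS'.mp hP') (hmemS'.mp hQ') h
  have hmain := budget_comparison S' S ι hιS hinjS (charge d A' N') (fun _ => betaTwo d A N) (charge d A N)
    (fun P' Q' => (pairVal P' Q').toNat) (fun P Q => (pairVal P Q).toNat) hq hc
  rw [conflictBudgetD_eq_sum hfinS' N', conflictBudgetD_eq_sum hfinS N, ← hSdef, ← hS'def]
  refine ⟨by omega, fun P₀ hP₀ hβ1 => ?_⟩
  -- strictness: `P₀` dies (charge ≥ 2 freed) or survives (slack `β ≥ 1`)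
  by_cases hsurv : ∃ P' ∈ S', ι P' = P₀
  · obtain ⟨P', hP', -⟩ := hsurv
    have h1 : betaTwo d A N ≤ ∑ P' ∈ S', betaTwo d A N :=
      Finset.single_le_sum (f := fun _ => betaTwo d A N) (fun _ _ => Nat.zero_le _) hP'
    omega
  · push Not at hsurv
    have hP₀S : P₀ ∈ S := hmemS.mpr hP₀
    have hmem : P₀ ∈ S.filter (fun Q => Q ∉ S'.image ι) := mem_filter_not_mem_image.mpr ⟨hP₀S, hsurv⟩
    have h1 : charge d A N P₀ ≤ ∑ Q ∈ S.filter (fun Q => Q ∉ S'.image ι), charge d A N Q :=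
      Finset.single_le_sum (fun _ _ => Nat.zero_le _) hmem
    have h2 : 2 ≤ charge d A N P₀ := two_le_charge p hd2 hsq (topPrimesDNL_subset_topPrimesNL d A hP₀) N
    omega

/-- **B6 STEP `u₁`-ORIGIN: the conf-law at the `u₁`-origin** — at a conflict state the budget DROPS (the conflict branch of D5 is in `topPrimesDNL`
with `β = 1`). -/
theorem conflictBudgetD_blowOneT_ltD (p : ℕ) [Fact p.Prime] [CharP k p] [IsAlgClosed k]
    (hΦ : ∀ f, Φ f = subst (![X 0, X 0 * X 1, X 0 * X 2] : Fin 3 → MvPowerSeries (Fin 3) k) f)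
    (hB3 : ∀ (P' : Ideal (MvPowerSeries (Fin 3) k)) [P'.IsPrime], ringKrullDim (MvPowerSeries (Fin 3) k ⧸ P') = 1 →
      (X 0 : MvPowerSeries (Fin 3) k) ∉ P' →
      ringKrullDim (MvPowerSeries (Fin 3) k ⧸ P'.comap Φ) = 1 ∧ ∀ f, branchVal (P'.comap Φ) f = branchVal P' (Φ f))
    (hB4 : ∀ (P' : Ideal (MvPowerSeries (Fin 3) k)), P' ∈ topPrimes d (blowOneT d A) → ringKrullDim (MvPowerSeries (Fin 3) k ⧸ P') = 1 → (X 0 : MvPowerSeries (Fin 3) k) ∉ P' →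
      P'.comap Φ ∈ topPrimes d A)
    (hD3 : ∀ (P Q : Ideal (MvPowerSeries (Fin 3) k)), P ∈ topPrimes d A → Q ∈ topPrimes d A → P ≠ Q →
      ringKrullDim (MvPowerSeries (Fin 3) k ⧸ P) = 1 → ringKrullDim (MvPowerSeries (Fin 3) k ⧸ Q) = 1 → pairVal P Q < ⊤)
    (hinj : ∀ (P' Q' : Ideal (MvPowerSeries (Fin 3) k)), P'.IsPrime → Q'.IsPrime → ringKrullDim (MvPowerSeries (Fin 3) k ⧸ P') = 1 →
      ringKrullDim (MvPowerSeries (Fin 3) k ⧸ Q') = 1 → (X 0 : MvPowerSeries (Fin 3) k) ∉ P' → (X 0 : MvPowerSeries (Fin 3) k) ∉ Q' →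
      P'.comap Φ = Q'.comap Φ → P' = Q')
    (hctx : ∃ (b : MvPowerSeries (Fin (2 + 1)) k) (δ : TameFourTupleDrop.Decoration k 2) (Θ : Fin (2 + 1) → MvPowerSeries (Fin (2 + 1)) k),
      TameFourTupleDrop.Admissible b δ ∧ 2 ≤ δ.o ∧ δ.c = d ∧ δ.PresBy d A N Θ)
    (hin : InPoly d A) (hconf : NCPoly.Conflict d A N) (hN' : N' = insert 0 (N.filter fun l => l = 1)) :
    conflictBudgetD d (blowOneT d A) N' < conflictBudgetD d A N := by
  have hd2 : 2 ≤ d := NCBranchPrimes.two_le_of_presContext hctx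
  have hsq : Squarefree (NCPoly.monicGerm d A) := NCBranchPrimes.squarefree_monicGerm_of_presContext hctx
  obtain ⟨P₀, hP₀, -⟩ := exists_transverse_of_conflict p hctx hin hconf
  have hP₀D : P₀ ∈ topPrimesDNL d A := mem_topPrimesDNL_of_mem_topPrimesNL hP₀ (ringKrullDim_eq_one_of_mem_topPrimes p hd2 hsq hP₀.1)
  have hβ1 : 1 ≤ betaTwo d A N := by rw [(betaTwo_eq_one_iff).mpr (Or.inl hconf.2.2.2)]
  exact (conflictBudgetD_blowOneT_leD Φ p hΦ hB3 hB4 hD3 hinj hctx hin hN').2 P₀ hP₀D hβ1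

end Step

/-- **B6 STEPS 2–3: A PLANE-FIXING CHART DOES NOT RAISE THE BUDGET.**  `Φ` fixes `toThree g`, `X 0`, `X 1`; `X e` is its exceptional variable
(`e = 0` for `divOneT`, `e = 1` for `divTwoT`); the letter bit of `(A′,N′)` equals that of `(A,N)`; bricks B3 / B4 / D3 / injectivity for `Φ`
and `e` as hypotheses; context for `(A,N)`.  Then `conflictBudgetD d A′ N′ ≤ conflictBudgetD d A N`. -/
theorem conflictBudgetD_le_of_planeFixingD (p : ℕ) [Fact p.Prime] [CharP k p] [IsAlgClosed k] {d : ℕ} {A A' : Fin d → MvPowerSeries (Fin 2) k}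
    {N N' : Finset (Fin 2)} (Φ : MvPowerSeries (Fin 3) k →ₐ[k] MvPowerSeries (Fin 3) k) (e : Fin 2)
    (hfix : ∀ g : MvPowerSeries (Fin 2) k, Φ (toThree g) = toThree g)
    (hB3 : ∀ (P' : Ideal (MvPowerSeries (Fin 3) k)) [P'.IsPrime], ringKrullDim (MvPowerSeries (Fin 3) k ⧸ P') = 1 →
      (X (Fin.castSucc e) : MvPowerSeries (Fin 3) k) ∉ P' →
      ringKrullDim (MvPowerSeries (Fin 3) k ⧸ P'.comap Φ) = 1 ∧ ∀ f, branchVal (P'.comap Φ) f = branchVal P' (Φ f))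
    (hB4 : ∀ (P' : Ideal (MvPowerSeries (Fin 3) k)), P' ∈ topPrimes d A' → ringKrullDim (MvPowerSeries (Fin 3) k ⧸ P') = 1 → (X (Fin.castSucc e) : MvPowerSeries (Fin 3) k) ∉ P' →
      P'.comap Φ ∈ topPrimes d A)
    (hD3 : ∀ (P Q : Ideal (MvPowerSeries (Fin 3) k)), P ∈ topPrimes d A → Q ∈ topPrimes d A → P ≠ Q →
      ringKrullDim (MvPowerSeries (Fin 3) k ⧸ P) = 1 → ringKrullDim (MvPowerSeries (Fin 3) k ⧸ Q) = 1 → pairVal P Q < ⊤)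
    (hinj : ∀ (P' Q' : Ideal (MvPowerSeries (Fin 3) k)), P'.IsPrime → Q'.IsPrime → ringKrullDim (MvPowerSeries (Fin 3) k ⧸ P') = 1 →
      ringKrullDim (MvPowerSeries (Fin 3) k ⧸ Q') = 1 → (X (Fin.castSucc e) : MvPowerSeries (Fin 3) k) ∉ P' →
      (X (Fin.castSucc e) : MvPowerSeries (Fin 3) k) ∉ Q' → P'.comap Φ = Q'.comap Φ → P' = Q')
    (hβ : betaTwo d A' N' = betaTwo d A N)
    (hctx : ∃ (b : MvPowerSeries (Fin (2 + 1)) k) (δ : TameFourTupleDrop.Decoration k 2) (Θ : Fin (2 + 1) → MvPowerSeries (Fin (2 + 1)) k),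
      TameFourTupleDrop.Admissible b δ ∧ 2 ≤ δ.o ∧ δ.c = d ∧ δ.PresBy d A N Θ) :
    conflictBudgetD d A' N' ≤ conflictBudgetD d A N := by
  classical
  have hΦX : ∀ i : Fin 2, Φ (X (Fin.castSucc i)) = X (Fin.castSucc i) := fun i => by rw [← toThree_X, hfix]
  have hΦX0 : Φ (X 0) = X 0 := hΦX 0
  have hΦX1 : Φ (X 1) = X 1 := hΦX 1
  have hXe : ∀ {P' : Ideal (MvPowerSeries (Fin 3) k)}, (X 0 : MvPowerSeries (Fin 3) k) ∉ P' → (X 1 : MvPowerSeries (Fin 3) k) ∉ P' →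
      (X (Fin.castSucc e) : MvPowerSeries (Fin 3) k) ∉ P' := by
    intro P' h0 h1; fin_cases e
    · exact h0
    · exact h1
  have hfinS : (topPrimesDNL d A).Finite := (topPrimesNL_finite p hctx).subset (topPrimesDNL_subset_topPrimesNL d A)
  set ι : Ideal (MvPowerSeries (Fin 3) k) → Ideal (MvPowerSeries (Fin 3) k) := fun P' => P'.comap Φ with hιdef
  have hιmem : ∀ P' ∈ topPrimesDNL d A', ι P' ∈ topPrimesDNL d A := by
    intro P' hP'
    obtain ⟨⟨hP'top, hdim'⟩, hX0', hX1'⟩ := hP'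
    haveI := hP'top.1
    obtain ⟨hdim, -⟩ := hB3 P' hdim' (hXe hX0' hX1')
    refine ⟨⟨hB4 P' hP'top hdim' (hXe hX0' hX1'), hdim⟩, ?_, ?_⟩
    · rw [hιdef, Ideal.mem_comap]; show Φ (X 0) ∉ P'; rw [hΦX0]; exact hX0'
    · rw [hιdef, Ideal.mem_comap]; show Φ (X 1) ∉ P'; rw [hΦX1]; exact hX1'
  have hinjOn : Set.InjOn ι (topPrimesDNL d A') := by
    intro P' hP' Q' hQ' h
    exact hinj P' Q' hP'.1.1.1 hQ'.1.1.1 hP'.1.2 hQ'.1.2 (hXe hP'.2.1 hP'.2.2) (hXe hQ'.2.1 hQ'.2.2) h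
  have hfinS' : (topPrimesDNL d A').Finite :=
    Set.Finite.of_finite_image (hfinS.subset (fun P hP => by obtain ⟨P', hP', rfl⟩ := hP; exact hιmem P' hP')) hinjOn
  set S := hfinS.toFinset with hSdef
  set S' := hfinS'.toFinset with hS'def
  have hmemS : ∀ {P}, P ∈ S ↔ P ∈ topPrimesDNL d A := fun {P} => Set.Finite.mem_toFinset _
  have hmemS' : ∀ {P'}, P' ∈ S' ↔ P' ∈ topPrimesDNL d A' := fun {P'} => Set.Finite.mem_toFinset _
  have hc : ∀ P' ∈ S', charge d A' N' P' ≤ charge d A N (ι P') +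
      2 * ∑ Q ∈ S.filter (fun Q => Q ∉ S'.image ι), ((pairVal (ι P') Q).toNat + (pairVal Q (ι P')).toNat) := by
    intro P' hP'
    obtain ⟨⟨hP'top, hdim'⟩, hX0', hX1'⟩ := hmemS'.mp hP'
    haveI := hP'top.1
    obtain ⟨-, hval⟩ := hB3 P' hdim' (hXe hX0' hX1')
    have h0 : branchVal P' (X 0) = branchVal (ι P') (X 0) := by rw [hιdef]; show _ = branchVal (P'.comap Φ) (X 0); rw [hval, hΦX0]
    have h1 : branchVal P' (X 1) = branchVal (ι P') (X 1) := by rw [hιdef]; show _ = branchVal (P'.comap Φ) (X 1); rw [hval, hΦX1]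
    exact le_add_right (charge_eq_of_vals hβ h0 h1).le
  -- pairs do not increase (`u = 1`)
  have hq : ∀ P' ∈ S', ∀ Q' ∈ S', P' ≠ Q' → (pairVal P' Q').toNat ≤ (pairVal (ι P') (ι Q')).toNat := by
    intro P' hP' Q' hQ' hne
    have hP'm := hmemS'.mp hP'
    have hQ'm := hmemS'.mp hQ'
    haveI := hP'm.1.1.1
    haveI := hQ'm.1.1.1
    obtain ⟨-, hval⟩ := hB3 P' hP'm.1.2 (hXe hP'm.2.1 hP'm.2.2)
    have hle : pairVal P' Q' + branchVal P' 1 ≤ pairVal (ι P') (ι Q') :=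
      pairVal_add_le_of_transport Φ.toRingHom (fun g => g) hfix hP'm.1.2 rfl rfl (fun f => (hval f).symm ▸ rfl) 1
        (fun h => hQ'm.1.1.1.ne_top ((Ideal.eq_top_iff_one _).mpr h)) fun g _ => ⟨g, by rw [one_mul]⟩
    have hιne : ι P' ≠ ι Q' := fun h => hne (hinjOn hP'm hQ'm h)
    have hfin : pairVal (ι P') (ι Q') < ⊤ :=
      hD3 _ _ (hιmem P' hP'm).1.1 (hιmem Q' hQ'm).1.1 hιne (hιmem P' hP'm).1.2 (hιmem Q' hQ'm).1.2
    exact ENat.toNat_le_toNat (le_trans le_self_add hle) hfin.ne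
  have hιS : ∀ P' ∈ S', ι P' ∈ S := fun P' hP' => hmemS.mpr (hιmem P' (hmemS'.mp hP'))
  have hinjS : Set.InjOn ι S' := fun P' hP' Q' hQ' h => hinjOn (hmemS'.mp hP') (hmemS'.mp hQ') h
  have hmain := budget_le S' S ι hιS hinjS (charge d A' N') (charge d A N) (fun P' Q' => (pairVal P' Q').toNat)
    (fun P Q => (pairVal P Q).toNat) hq hc
  rw [conflictBudgetD_eq_sum hfinS' N', conflictBudgetD_eq_sum hfinS N, ← hSdef, ← hS'def]
  exact hmain

section StepTwo

variable {d : ℕ} {A : Fin d → MvPowerSeries (Fin 2) k} {N N' : Finset (Fin 2)}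
  (Φ : MvPowerSeries (Fin 3) k →ₐ[k] MvPowerSeries (Fin 3) k)

/-- **B6 STEP `u₂`-ORIGIN.**  `M′ ≤ M`, and `M′ < M` as soon as some non-line one-dimensional top-locus prime of `A` with `v(u₁) = 1` exists
(such a prime never survives at the `u₂`-origin: `a = a′ + b′ ≥ 2` there). -/
theorem conflictBudgetD_blowTwoT_leD (p : ℕ) [Fact p.Prime] [CharP k p] [IsAlgClosed k]
    (hΦ : ∀ f, Φ f = subst (![X 0 * X 1, X 1, X 1 * X 2] : Fin 3 → MvPowerSeries (Fin 3) k) f)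
    (hB3 : ∀ (P' : Ideal (MvPowerSeries (Fin 3) k)) [P'.IsPrime], ringKrullDim (MvPowerSeries (Fin 3) k ⧸ P') = 1 →
      (X 1 : MvPowerSeries (Fin 3) k) ∉ P' →
      ringKrullDim (MvPowerSeries (Fin 3) k ⧸ P'.comap Φ) = 1 ∧ ∀ f, branchVal (P'.comap Φ) f = branchVal P' (Φ f))
    (hB4 : ∀ (P' : Ideal (MvPowerSeries (Fin 3) k)), P' ∈ topPrimes d (blowTwoT d A) → ringKrullDim (MvPowerSeries (Fin 3) k ⧸ P') = 1 → (X 1 : MvPowerSeries (Fin 3) k) ∉ P' →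
      P'.comap Φ ∈ topPrimes d A)
    (hD3 : ∀ (P Q : Ideal (MvPowerSeries (Fin 3) k)), P ∈ topPrimes d A → Q ∈ topPrimes d A → P ≠ Q →
      ringKrullDim (MvPowerSeries (Fin 3) k ⧸ P) = 1 → ringKrullDim (MvPowerSeries (Fin 3) k ⧸ Q) = 1 → pairVal P Q < ⊤)
    (hinj : ∀ (P' Q' : Ideal (MvPowerSeries (Fin 3) k)), P'.IsPrime → Q'.IsPrime → ringKrullDim (MvPowerSeries (Fin 3) k ⧸ P') = 1 →
      ringKrullDim (MvPowerSeries (Fin 3) k ⧸ Q') = 1 → (X 1 : MvPowerSeries (Fin 3) k) ∉ P' → (X 1 : MvPowerSeries (Fin 3) k) ∉ Q' →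
      P'.comap Φ = Q'.comap Φ → P' = Q')
    (hctx : ∃ (b : MvPowerSeries (Fin (2 + 1)) k) (δ : TameFourTupleDrop.Decoration k 2) (Θ : Fin (2 + 1) → MvPowerSeries (Fin (2 + 1)) k),
      TameFourTupleDrop.Admissible b δ ∧ 2 ≤ δ.o ∧ δ.c = d ∧ δ.PresBy d A N Θ)
    (hN' : N' = insert 1 (N.filter fun l => l = 0)) :
    conflictBudgetD d (blowTwoT d A) N' ≤ conflictBudgetD d A N ∧
      ∀ P₀ ∈ topPrimesDNL d A, branchVal P₀ (X 0) = 1 → conflictBudgetD d (blowTwoT d A) N' < conflictBudgetD d A N := by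
  classical
  have hd2 : 2 ≤ d := NCBranchPrimes.two_le_of_presContext hctx
  have hsq : Squarefree (NCPoly.monicGerm d A) := NCBranchPrimes.squarefree_monicGerm_of_presContext hctx
  set A' := blowTwoT d A with hA'
  have hs : HasSubst (![X 0 * X 1, X 1, X 1 * X 2] : Fin 3 → MvPowerSeries (Fin 3) k) :=
    hasSubst_of_constantCoeff_zero fun i => by fin_cases i <;> simp
  have hΦX0 : Φ (X 0) = X 0 * X 1 := by rw [hΦ, subst_X hs]; rfl
  have hΦX1 : Φ (X 1) = X 1 := by rw [hΦ, subst_X hs]; rfl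
  have hΦ₂ : ∀ g : MvPowerSeries (Fin 2) k, Φ (toThree g) = toThree (subst (![X 0 * X 1, X 1] : Fin 2 → MvPowerSeries (Fin 2) k) g) := by
    intro g
    rw [hΦ, toThree]
    exact subst_rename_eq_rename_subst _ (fun i => by fin_cases i <;> simp) _ (fun i => by fin_cases i <;> simp)
      (fun i => by fin_cases i <;> simp [rename_X, map_mul, succAbove_two_one]) g
  have hβ' : betaTwo d A' N' = 1 := (betaTwo_eq_one_iff).mpr (Or.inl (by rw [hN']; simp))
  -- index sets
  have hfinS : (topPrimesDNL d A).Finite := (topPrimesNL_finite p hctx).subset (topPrimesDNL_subset_topPrimesNL d A)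
  set ι : Ideal (MvPowerSeries (Fin 3) k) → Ideal (MvPowerSeries (Fin 3) k) := fun P' => P'.comap Φ with hιdef
  have hιmem : ∀ P' ∈ topPrimesDNL d A', ι P' ∈ topPrimesDNL d A := by
    intro P' hP'
    obtain ⟨⟨hP'top, hdim'⟩, hX0', hX1'⟩ := hP'
    haveI := hP'top.1
    obtain ⟨hdim, -⟩ := hB3 P' hdim' hX1'
    refine ⟨⟨hB4 P' hP'top hdim' hX1', hdim⟩, ?_, ?_⟩
    · rw [hιdef, Ideal.mem_comap]; show Φ (X 0) ∉ P'; rw [hΦX0]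
      exact fun h => (hP'top.1.mem_or_mem h).elim hX0' hX1'
    · rw [hιdef, Ideal.mem_comap]; show Φ (X 1) ∉ P'; rw [hΦX1]; exact hX1'
  have hinjOn : Set.InjOn ι (topPrimesDNL d A') := by
    intro P' hP' Q' hQ' h
    exact hinj P' Q' hP'.1.1.1 hQ'.1.1.1 hP'.1.2 hQ'.1.2 hP'.2.2 hQ'.2.2 h
  have hfinS' : (topPrimesDNL d A').Finite :=
    Set.Finite.of_finite_image (hfinS.subset (fun P hP => by obtain ⟨P', hP', rfl⟩ := hP; exact hιmem P' hP')) hinjOn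
  set S := hfinS.toFinset with hSdef
  set S' := hfinS'.toFinset with hS'def
  have hmemS : ∀ {P}, P ∈ S ↔ P ∈ topPrimesDNL d A := fun {P} => Set.Finite.mem_toFinset _
  have hmemS' : ∀ {P'}, P' ∈ S' ↔ P' ∈ topPrimesDNL d A' := fun {P'} => Set.Finite.mem_toFinset _
  have hvals : ∀ P' ∈ topPrimesDNL d A',
      branchVal P' (X 0) ≠ ⊤ ∧ branchVal P' (X 1) ≠ ⊤ ∧ 1 ≤ branchVal P' (X 0) ∧ 1 ≤ branchVal P' (X 1) ∧
      branchVal P' (X 1) = branchVal (ι P') (X 1) ∧ branchVal P' (X 0) + branchVal P' (X 1) = branchVal (ι P') (X 0) := by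
    intro P' hP'
    obtain ⟨⟨hP'top, hdim'⟩, hX0', hX1'⟩ := hP'
    haveI := hP'top.1
    obtain ⟨-, hval⟩ := hB3 P' hdim' hX1'
    refine ⟨(branchVal_eq_top_iff_of_dim hdim' _).not.mpr hX0', (branchVal_eq_top_iff_of_dim hdim' _).not.mpr hX1',
      one_le_branchVal_X_of_dim hdim' 0, one_le_branchVal_X_of_dim hdim' 1, ?_, ?_⟩
    · rw [hιdef]; show _ = branchVal (P'.comap Φ) (X 1); rw [hval, hΦX1]
    · rw [hιdef]; show _ = branchVal (P'.comap Φ) (X 0); rw [hval, hΦX0, branchVal_mul_of_dim hdim']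
  have hc : ∀ P' ∈ S', charge d A' N' P' + 1 ≤ charge d A N (ι P') +
      2 * ∑ Q ∈ S.filter (fun Q => Q ∉ S'.image ι), ((pairVal (ι P') Q).toNat + (pairVal Q (ι P')).toNat) := by
    intro P' hP'
    obtain ⟨ha', hb', h1a, h1b, hbb, haa⟩ := hvals P' (hmemS'.mp hP')
    exact le_add_right (charge_chartTwo_le hβ' ha' hb' h1a h1b hbb haa)
  have hq : ∀ P' ∈ S', ∀ Q' ∈ S', P' ≠ Q' → (pairVal P' Q').toNat ≤ (pairVal (ι P') (ι Q')).toNat := by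
    intro P' hP' Q' hQ' hne
    have hP'm := hmemS'.mp hP'
    have hQ'm := hmemS'.mp hQ'
    haveI := hP'm.1.1.1
    haveI := hQ'm.1.1.1
    obtain ⟨-, hval⟩ := hB3 P' hP'm.1.2 hP'm.2.2
    have hle : pairVal P' Q' + branchVal P' (X 1) ≤ pairVal (ι P') (ι Q') :=
      pairVal_add_le_of_transport Φ.toRingHom (subst (![X 0 * X 1, X 1] : Fin 2 → MvPowerSeries (Fin 2) k)) hΦ₂ hP'm.1.2 rfl rfl
        (fun f => (hval f).symm ▸ rfl) (X 1) hQ'm.2.2 fun g hg0 => by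
          obtain ⟨ĝ, hĝ⟩ := exists_chartTwo_eq_mul hg0
          exact ⟨ĝ, by rw [hĝ, map_mul, toThree_X]; rfl⟩
    have hιne : ι P' ≠ ι Q' := fun h => hne (hinjOn hP'm hQ'm h)
    have hfin : pairVal (ι P') (ι Q') < ⊤ :=
      hD3 _ _ (hιmem P' hP'm).1.1 (hιmem Q' hQ'm).1.1 hιne (hιmem P' hP'm).1.2 (hιmem Q' hQ'm).1.2
    exact ENat.toNat_le_toNat (le_trans le_self_add hle) hfin.ne
  have hιS : ∀ P' ∈ S', ι P' ∈ S := fun P' hP' => hmemS.mpr (hιmem P' (hmemS'.mp hP'))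
  have hinjS : Set.InjOn ι S' := fun P' hP' Q' hQ' h => hinjOn (hmemS'.mp hP') (hmemS'.mp hQ') h
  have hmain := budget_comparison S' S ι hιS hinjS (charge d A' N') (fun _ => 1) (charge d A N)
    (fun P' Q' => (pairVal P' Q').toNat) (fun P Q => (pairVal P Q).toNat) hq hc
  rw [conflictBudgetD_eq_sum hfinS' N', conflictBudgetD_eq_sum hfinS N, ← hSdef, ← hS'def]
  refine ⟨by omega, fun P₀ hP₀ ha₀ => ?_⟩
  -- `P₀` does not survive: a surviving image has `v(u₁) = a′ + b′ ≥ 2`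
  have hsurv : ∀ P' ∈ S', ι P' ≠ P₀ := by
    intro P' hP' h
    obtain ⟨ha', hb', h1a, h1b, -, haa⟩ := hvals P' (hmemS'.mp hP')
    rw [h, ha₀] at haa
    have h2 : (2 : ℕ∞) ≤ branchVal P' (X 0) + branchVal P' (X 1) := by
      calc (2 : ℕ∞) = 1 + 1 := by norm_num
        _ ≤ _ := add_le_add h1a h1b
    rw [haa] at h2
    exact absurd h2 (by norm_num)
  have hP₀S : P₀ ∈ S := hmemS.mpr hP₀
  have hmem : P₀ ∈ S.filter (fun Q => Q ∉ S'.image ι) := mem_filter_not_mem_image.mpr ⟨hP₀S, hsurv⟩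
  have h1 : charge d A N P₀ ≤ ∑ Q ∈ S.filter (fun Q => Q ∉ S'.image ι), charge d A N Q :=
    Finset.single_le_sum (fun _ _ => Nat.zero_le _) hmem
  have h2 : 2 ≤ charge d A N P₀ := two_le_charge p hd2 hsq (topPrimesDNL_subset_topPrimesNL d A hP₀) N
  omega

/-- **B6 STEP `u₂`-ORIGIN: the conf-law** — at a conflict state the budget drops (the conflict branch of D5 dies). -/
theorem conflictBudgetD_blowTwoT_ltD (p : ℕ) [Fact p.Prime] [CharP k p] [IsAlgClosed k]
    (hΦ : ∀ f, Φ f = subst (![X 0 * X 1, X 1, X 1 * X 2] : Fin 3 → MvPowerSeries (Fin 3) k) f)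
    (hB3 : ∀ (P' : Ideal (MvPowerSeries (Fin 3) k)) [P'.IsPrime], ringKrullDim (MvPowerSeries (Fin 3) k ⧸ P') = 1 →
      (X 1 : MvPowerSeries (Fin 3) k) ∉ P' →
      ringKrullDim (MvPowerSeries (Fin 3) k ⧸ P'.comap Φ) = 1 ∧ ∀ f, branchVal (P'.comap Φ) f = branchVal P' (Φ f))
    (hB4 : ∀ (P' : Ideal (MvPowerSeries (Fin 3) k)), P' ∈ topPrimes d (blowTwoT d A) → ringKrullDim (MvPowerSeries (Fin 3) k ⧸ P') = 1 → (X 1 : MvPowerSeries (Fin 3) k) ∉ P' →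
      P'.comap Φ ∈ topPrimes d A)
    (hD3 : ∀ (P Q : Ideal (MvPowerSeries (Fin 3) k)), P ∈ topPrimes d A → Q ∈ topPrimes d A → P ≠ Q →
      ringKrullDim (MvPowerSeries (Fin 3) k ⧸ P) = 1 → ringKrullDim (MvPowerSeries (Fin 3) k ⧸ Q) = 1 → pairVal P Q < ⊤)
    (hinj : ∀ (P' Q' : Ideal (MvPowerSeries (Fin 3) k)), P'.IsPrime → Q'.IsPrime → ringKrullDim (MvPowerSeries (Fin 3) k ⧸ P') = 1 →
      ringKrullDim (MvPowerSeries (Fin 3) k ⧸ Q') = 1 → (X 1 : MvPowerSeries (Fin 3) k) ∉ P' → (X 1 : MvPowerSeries (Fin 3) k) ∉ Q' →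
      P'.comap Φ = Q'.comap Φ → P' = Q')
    (hctx : ∃ (b : MvPowerSeries (Fin (2 + 1)) k) (δ : TameFourTupleDrop.Decoration k 2) (Θ : Fin (2 + 1) → MvPowerSeries (Fin (2 + 1)) k),
      TameFourTupleDrop.Admissible b δ ∧ 2 ≤ δ.o ∧ δ.c = d ∧ δ.PresBy d A N Θ)
    (hin : InPoly d A) (hconf : NCPoly.Conflict d A N) (hN' : N' = insert 1 (N.filter fun l => l = 0)) :
    conflictBudgetD d (blowTwoT d A) N' < conflictBudgetD d A N := by
  have hd2 : 2 ≤ d := NCBranchPrimes.two_le_of_presContext hctx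
  have hsq : Squarefree (NCPoly.monicGerm d A) := NCBranchPrimes.squarefree_monicGerm_of_presContext hctx
  obtain ⟨P₀, hP₀, ha₀⟩ := exists_transverse_of_conflict p hctx hin hconf
  have hP₀D : P₀ ∈ topPrimesDNL d A := mem_topPrimesDNL_of_mem_topPrimesNL hP₀ (ringKrullDim_eq_one_of_mem_topPrimes p hd2 hsq hP₀.1)
  exact (conflictBudgetD_blowTwoT_leD Φ p hΦ hB3 hB4 hD3 hinj hctx hN').2 P₀ hP₀D ha₀

end StepTwo

end TOT2Branch

end Summit.ResolutionOfSingularities.ResolutionOfSingularities.Theorems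

end
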